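/-
Copyright (c) 2026. All rights reserved.
Released under Apache 2.0 license as described in the file LICENSE.
-/
import Literature.NumberTheory.Automorphic.MaximalOrderDiscSevenClassNumberOne
import Literature.NumberTheory.Automorphic.MaximalOrderDiscSevenRamification
import Literature.NumberTheory.Automorphic.MaximalOrderDiscSevenNormsSevenMul
import Literature.NumberTheory.Automorphic.BrandtModuleLevelOneTwo
import Literature.NumberTheory.Automorphic.BrandtMatrixRamified
import Literature.NumberTheory.Automorphic.EichlerSubidealCount
import Literature.NumberTheory.Automorphic.BrandtMultiplicativityHolds
import HarnessLib

/-!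
# The Brandt setups of type `(N⁺, N⁻) = (1, 7)`: `h = 1`, `w = 2`, `Σ 1/w = 1/2` (Eichler's mass formula), `T(p) = (p + 1)`
# for primes `p ≠ 7`, `T(7ᵃ) = (1)` — for EVERY setup / Eichler package of that type and for `brandtModule 1 7`; and the
# representation numbers of `a² + ac + 2c² + b² + bd + 2d²`: `r₇(p) = 4(p + 1)` (`p ≠ 7`), `r₇(7ᵃm) = 4σ(m)`
# (`m` squarefree, `7 ∤ m`)

[tag: quaternion_algebra] [tag: brandt_matrix] [tag: class_number] [tag: mass_formula]

Topic `NumberTheory/Automorphic`; THEOREMS ONLY (no definition, no named fact, no instance; net Literature debt `0`).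
Lane `lit-hodgefound`, seat p12, gen 46 — sixth file of the series on the definite quaternion order of (reduced) discriminant `7`
(`MaximalOrderDiscSevenLattice`: `O₇ = ℤ⟨1, i, ω, iω⟩ ⊂ (−1,−7 ∣ ℚ)`, `ω = (1+j)/2`, maximal, `#O₇^× = 4`, `w(O₇) = 2`;
`…Ramification`: `Ram_f = {7}`, totally definite; `…DedekindHasse` + `…ClassNumberOne`: `# Cls O₇ = 1` although the order is NOT
norm-Euclidean (Voight Exercise 17.10 (c); Cardoso–Machiavelo Thm. 8); `…NormsSevenMul`: `r₇(7ᵃn) = r₇(n)`). It is the `D = 7` twin of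
`MaximalOrderDiscThreeBrandtSetup` ∕ `MaximalOrderDiscFiveBrandtSetup`: it assembles the Brandt SETUP `(ℍ[ℚ,−1,−7], O₇) : Brandt.XiSetup 1 7`
(a structure value, built inside the proofs) and transports its data to every abstract object of type `(1, 7)` of the tree — the
algebra of a setup of type `(1, 7)` is isomorphic to `(−1,−7)_ℚ` (same ramification, Vignéras III §3 Thm. 3.1 = the tree's
`nonempty_algEquiv_of_ramifiedPlaces_eq_holds`), its Eichler order is tied to the image of `O₇` by a connecting ideal
(`IsEichlerOrder.exists_isInvertibleRightIdeal_leftOrderOf_eq`), and class sets, weights and Brandt matrices correspond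
(`exists_classSetEquiv_map_ringEquiv`, `exists_classSetEquiv_leftOrder`):

* §1 (at `O₇`) `matrix_prime` (**`T(p)_ij = p + 1` for primes `p ≠ 7`** — Eichler's column sum `p + 1` at a good prime,
  `XiSetup.sum_matrix_prime_eq`, on the one-point class set), **`natCard_reducedNorm_eq_four_mul_matrix`**
  (`#{x ∈ O₇ : nrd x = n} = 2w·T(n)_ii = 4·T(n)_ii`), **`matrix_seven_pow`** (`T(7ᵃ)_ij = 1` FOR EVERY `a` — read off the
  elementary count `#{x ∈ O₇ : nrd x = 7ᵃ} = 4` of `…NormsSevenMul`), `matrix_seven`, `matrix_seven_mul_self` (`T(7)² = 1`,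
  Eichler (20)), `matrix_one'`, `matrix_mul_of_coprime'`, `matrix_apply_mul_of_coprime`; **`natCard_reducedNorm_prime`**
  (`#{x ∈ O₇ : nrd x = p} = 4(p + 1)` for primes `p ≠ 7`) and, in the coordinates of `O₇`, **`natCard_form_prime`**: THE NUMBER
  OF `(a,b,c,d) ∈ ℤ⁴` WITH `a² + ac + 2c² + b² + bd + 2d² = p` IS `4(p + 1)` FOR EVERY PRIME `p ≠ 7` (Eichler's Cor. 1:
  the row sums of `B(n)` are `Σ_{d ∣ n, 7 ∤ d} d`; here by the class-number-one ∕ Hecke route); by multiplicativity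
  **`matrix_apply_of_squarefree`** (`T(n)_ij = σ(n)`, `n` squarefree, `7 ∤ n`), **`matrix_apply_seven_pow_mul`**
  (`T(7ᵃm)_ij = T(m)_ij`, `7 ∤ m`), `matrix_apply_seven_pow_mul_of_squarefree`, **`natCard_form_of_squarefree`**
  (`r₇(n) = 4σ(n)` for squarefree `n` prime to `7`) and **`natCard_form_seven_pow_mul_of_squarefree`** (`r₇(7ᵃm) = 4σ(m)`),
  `natCard_reducedNorm_seven_pow_mul_of_squarefree`;
* §2 (every `S : XiSetup 1 7`) `xiSetup_nonempty_algEquiv` (`S.D ≃ₐ[ℚ] ℍ[ℚ,−1,−7]`: THE definite quaternion algebra of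
  discriminant `7`), **`xiSetup_natCard_classSet`** (`# Cls S.O = 1` — VOIGHT THM. 25.4.1 AT `D = 7`), `xiSetup_subsingleton_classSet`,
  `xiSetup_card_classSet`, **`xiSetup_weight`** (`w_c = 2`), **`xiSetup_sum_inv_weight`** (`Σ_c 1/w_c = 1/2 = φ(7)/12` — EICHLER'S
  MASS FORMULA AT `(D, N) = (7, 1)`, Voight Thm. 25.1.1), `xiSetup_matrix_prime`, `xiSetup_matrix_seven_pow`, `xiSetup_matrix_seven`,
  `xiSetup_matrix_one`, `xiSetup_matrix_apply_of_squarefree`;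
* §3 (every `P : EichlerPackage 1 7`) `eichlerPackage_natCard_ι`, **`eichlerPackage_classNumber`** (`h = 1`), `eichlerPackage_w`
  (`w_i = 2`), `eichlerPackage_sum_inv_w`, **`eichlerPackage_massFormula`** — THE LEVEL-`(1, 7)` CLAUSE OF THE NAMED FACT
  `brandtModule_massFormula`, UNCONDITIONALLY (`Σ_i 1/w_i = (1/12)·∏_{q∣7}(q − 1)·∏_{p∣1}(…) = 6/12 = 1/2`), `eichlerPackage_T_prime`,
  `eichlerPackage_T_seven_pow`, `eichlerPackage_T_seven`;
* §4 (the chosen data) `nonempty_eichlerPackage_one_seven` (an explicit package `(ℍ[ℚ,−1,−7], O₇)`),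
  **`brandtModule_one_seven_classNumber`** (`= 1`), **`brandtModule_one_seven_w`** (`= 2`), `brandtModule_one_seven_sum_inv_w`
  (`= 1/2`), `brandtModule_one_seven_T_prime`, `brandtModule_one_seven_T_seven_pow`.

The values `T(pᵃ)` for `a ≥ 2`, `p ≠ 7` (Hecke recursion) are deferred to a sequel.

## Sources

* J. Voight, *Quaternion Algebras*, GTM 288 (2021): Thm. 25.4.1 («`# Cls O = 1` if and only if `D = 2, 3, 5, 7, 13`» — here
  `D = 7`, direction ⇐), Exercise 17.10 ((a) «Show that maximal orders `O` in quaternion algebras of discriminants `5, 7, 13` have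
  `# Cls O = 1`»; (b) the norm forms are multiplicative; (c) «for discriminant `7, 13` the maximal orders are not Euclidean with respect
  to the norm»), Thm. 25.1.1 (Eichler mass formula over `ℚ`: `Σ_{[J] ∈ Cls O} 1/w_J = φ(D)/12`, `w_J = #O_L(J)^×/{±1}`), Thm. 11.5.14
  (unit groups of definite orders), Exercise 11.14 (c) (number of right ideals of reduced norm `p` is `p + 1`), 41.1.3 (weights),
  Lemma 41.2.7. [cite: Voight2021, Thm. 25.4.1 (D = 7); Exercise 17.10; Thm. 25.1.1; Thm. 11.5.14; Exercise 11.14 (c); Lemma 41.2.7]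
* M.-F. Vignéras, *Arithmétique des algèbres de quaternions*, LNM 800 (1980): Ch. III §3 Thm. 3.1 (classification by
  ramification), Ch. III §5 Cor. 5.5 and §5 B (Eichler orders of the same level are tied by an ideal), exercice 5.8
  (Brandt matrices), Ch. V §2 Cor. 2.3 (formule de masse: `(1/12)∏_{p∣D}(p − 1) = 6/12`). [cite: VignerasLNM800, Ch. III §3 Thm. 3.1; Ch. III §5 Cor. 5.5, §5 B, exercice 5.8; Ch. V §2 Cor. 2.3]
* M. Eichler, LNM 320 (1973), Ch. II §6 (16), Thm. 2 (18)–(20) and Cor. 1 (column sums `p + 1`; `B(p)` at `p ∣ D`; row sums).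
  [cite: Eichler1973, Ch. II §6 (16), Thm. 2 (18)–(20) and Cor. 1]
* A. Cardoso, A. Machiavelo, arXiv:2506.22651 (2025), §5.1 and Thm. 8 (the order `H₁,₇`, class number one without a Euclidean
  algorithm). [cite: CardosoMachiavelo2025, §5.1 and Thm. 8]
* A. Pizer, *An algorithm for computing modular forms on Γ₀(N)*, J. Algebra 64 (1980), §2. [cite: Pizer1980, §2]

## Scope (honest)

Theorems only — no definition, no named fact, no instance. Level `(1, 7)` only. Brandt matrices and representation numbers in
closed form only when the `7`-free part of the argument is squarefree; general prime powers `pᵃ` (`p ≠ 7`, `a ≥ 2`) await the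
Hecke recursion (`BrandtHeckeFamily`).
-/

open Quaternion
open Finset
open scoped Pointwise
open Literature.NumberTheory.Automorphic.Brandt

namespace Literature.NumberTheory.Automorphic.MaxOrderDiscSeven

/-! ## §1 The setup `(ℍ[ℚ,−1,−7], O₇)`: `T(p)`, `T(7ᵃ)`, and the representation numbers `r₇` -/

section AtO

/-- The class set of `O₇` is finite (a point). [folklore] -/
private theorem finite_classSet₇ : Finite (ClassSet (Submodule.span ℤ (Set.range ![(⟨1, 0, 0, 0⟩ : ℍ[ℚ,-1,-7]), ⟨0, 1, 0, 0⟩, ⟨1/2, 0, 1/2, 0⟩, ⟨0, 1/2, 0, 1/2⟩]))) :=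
  haveI := isQuaternionAlgebra
  Brandt.finite_classSet ℚ isOrder_lattice

/-- The facts about `O₇` read off the Brandt setup `(ℍ[ℚ,−1,−7], O₇) : XiSetup 1 7` (a structure VALUE): Eichler's column
sums `p + 1` at `p ≠ 7`, `T(7)² = 1`, multiplicativity, and `2w_i T(n)_ii = #{x ∈ O_L(I_i) : nrd x = n}`. [folklore] -/
private theorem setup_facts :
    (∀ [Fintype (ClassSet (Submodule.span ℤ (Set.range ![(⟨1, 0, 0, 0⟩ : ℍ[ℚ,-1,-7]), ⟨0, 1, 0, 0⟩, ⟨1/2, 0, 1/2, 0⟩, ⟨0, 1/2, 0, 1/2⟩])))] {p : ℕ}, p.Prime → ¬ p ∣ 7 → ∀ j : ClassSet (Submodule.span ℤ (Set.range ![(⟨1, 0, 0, 0⟩ : ℍ[ℚ,-1,-7]), ⟨0, 1, 0, 0⟩, ⟨1/2, 0, 1/2, 0⟩, ⟨0, 1/2, 0, 1/2⟩])), ∑ i, matrix (Submodule.span ℤ (Set.range ![(⟨1, 0, 0, 0⟩ : ℍ[ℚ,-1,-7]), ⟨0, 1, 0, 0⟩, ⟨1/2, 0, 1/2, 0⟩,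 ⟨0, 1/2, 0, 1/2⟩])) p i j = p + 1) ∧
    (∀ [Fintype (ClassSet (Submodule.span ℤ (Set.range ![(⟨1, 0, 0, 0⟩ : ℍ[ℚ,-1,-7]), ⟨0, 1, 0, 0⟩, ⟨1/2, 0, 1/2, 0⟩, ⟨0, 1/2, 0, 1/2⟩])))] [DecidableEq (ClassSet (Submodule.span ℤ (Set.range ![(⟨1, 0, 0, 0⟩ : ℍ[ℚ,-1,-7]), ⟨0, 1, 0, 0⟩, ⟨1/2, 0, 1/2, 0⟩, ⟨0, 1/2, 0, 1/2⟩])))], matrix (Submodule.span ℤ (Set.range ![(⟨1, 0, 0, 0⟩ : ℍ[ℚ,-1,-7]), ⟨0, 1, 0, 0⟩, ⟨1/2, 0, 1/2, 0⟩, ⟨0, 1/2, 0, 1/2⟩])) 7 * matrix (Submodule.span ℤ (Set.range ![(⟨1, 0, 0, 0⟩ : ℍ[ℚ,-1,-7]), ⟨0, 1, 0, 0⟩, ⟨1/2, 0, 1/2, 0⟩, ⟨0, 1/2, 0, 1/2⟩])) 7 = 1) ∧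
    (∀ [Fintype (ClassSet (Submodule.span ℤ (Set.range ![(⟨1, 0, 0, 0⟩ : ℍ[ℚ,-1,-7]), ⟨0, 1, 0, 0⟩, ⟨1/2, 0, 1/2, 0⟩, ⟨0, 1/2, 0, 1/2⟩])))] {m n : ℕ}, Nat.Coprime m n → matrix (Submodule.span ℤ (Set.range ![(⟨1, 0, 0, 0⟩ : ℍ[ℚ,-1,-7]), ⟨0, 1, 0, 0⟩, ⟨1/2, 0, 1/2, 0⟩, ⟨0, 1/2, 0, 1/2⟩])) (m * n) = matrix (Submodule.span ℤ (Set.range ![(⟨1, 0, 0, 0⟩ : ℍ[ℚ,-1,-7]), ⟨0, 1, 0, 0⟩, ⟨1/2, 0, 1/2, 0⟩, ⟨0, 1/2, 0, 1/2⟩])) m * matrix (Submodule.span ℤ (Set.range ![(⟨1, 0, 0, 0⟩ : ℍ[ℚ,-1,-7]), ⟨0, 1, 0, 0⟩, ⟨1/2, 0, 1/2, 0⟩, ⟨0, 1/2, 0, 1/2⟩])) n) ∧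
    (∀ {n : ℕ}, n ≠ 0 → ∀ i : ClassSet (Submodule.span ℤ (Set.range ![(⟨1, 0, 0, 0⟩ : ℍ[ℚ,-1,-7]), ⟨0, 1, 0, 0⟩, ⟨1/2, 0, 1/2, 0⟩, ⟨0, 1/2, 0, 1/2⟩])), (2 * weight (Submodule.span ℤ (Set.range ![(⟨1, 0, 0, 0⟩ : ℍ[ℚ,-1,-7]), ⟨0, 1, 0, 0⟩, ⟨1/2, 0, 1/2, 0⟩, ⟨0, 1/2, 0, 1/2⟩])) i : ℤ) * matrix (Submodule.span ℤ (Set.range ![(⟨1, 0, 0, 0⟩ : ℍ[ℚ,-1,-7]), ⟨0, 1, 0, 0⟩, ⟨1/2, 0, 1/2, 0⟩, ⟨0, 1/2, 0, 1/2⟩])) n i i =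
      Nat.card {x : ℍ[ℚ,-1,-7] // x ∈ leftOrder i.rep ∧ reducedNorm ℚ ℍ[ℚ,-1,-7] x = n}) := by
  haveI := isQuaternionAlgebra
  let S : XiSetup 1 7 :=
    { D := ℍ[ℚ,-1,-7]
      isTotallyDefinite := isTotallyDefinite
      squarefree := Nat.prime_seven.prime.squarefree
      ramifiedPlaces_eq := ramifiedPlaces_eq
      O := (Submodule.span ℤ (Set.range ![(⟨1, 0, 0, 0⟩ : ℍ[ℚ,-1,-7]), ⟨0, 1, 0, 0⟩, ⟨1/2, 0, 1/2, 0⟩, ⟨0, 1/2, 0, 1/2⟩]))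
      isEichlerOrder := brandt_isEichlerOrder_one_lattice }
  refine ⟨fun {_} {p} hp hp7 j => ?_, fun {_} {_} => ?_, fun {_} {m} {n} hmn => ?_, fun {n} hn i => ?_⟩
  · exact S.sum_matrix_prime_eq hp (by rwa [one_mul]) j
  · exact S.matrix_mul_self_of_dvd Nat.prime_seven (dvd_refl 7)
  · exact S.matrix_mul_of_coprime hmn
  · exact S.two_mul_weight_mul_matrix_diag hn i

/-- The Brandt matrices have non-negative entries (they count ideals). [folklore] -/
private theorem matrix_nonneg (n : ℕ) (i j : ClassSet (Submodule.span ℤ (Set.range ![(⟨1, 0, 0, 0⟩ : ℍ[ℚ,-1,-7]), ⟨0, 1, 0, 0⟩, ⟨1/2, 0, 1/2, 0⟩, ⟨0, 1/2, 0, 1/2⟩]))) : 0 ≤ matrix (Submodule.span ℤ (Set.range ![(⟨1, 0, 0, 0⟩ : ℍ[ℚ,-1,-7]), ⟨0, 1, 0, 0⟩, ⟨1/2, 0, 1/2, 0⟩, ⟨0, 1/2, 0, 1/2⟩])) n i j := by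
  rw [matrix, Matrix.of_apply]
  exact Int.natCast_nonneg _

/-- **`T(p)_ij = p + 1` for every prime `p ≠ 7`** (at `O₇`: the `p + 1` right ideals of reduced norm `p` of a maximal order at
a split prime, on the one-point class set). [cite: Voight2021, Exercise 11.14 (c) and Thm. 25.4.1 (D = 7)] [cite: Eichler1973, Ch. II §6 (16)] -/
theorem matrix_prime {p : ℕ} (hp : p.Prime) (hp7 : p ≠ 7) (i j : ClassSet (Submodule.span ℤ (Set.range ![(⟨1, 0, 0, 0⟩ : ℍ[ℚ,-1,-7]), ⟨0, 1, 0, 0⟩, ⟨1/2, 0, 1/2, 0⟩, ⟨0, 1/2, 0, 1/2⟩]))) : matrix (Submodule.span ℤ (Set.range ![(⟨1, 0, 0, 0⟩ : ℍ[ℚ,-1,-7]), ⟨0, 1, 0, 0⟩, ⟨1/2, 0, 1/2, 0⟩, ⟨0, 1/2, 0, 1/2⟩])) p i j = p + 1 := by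
  haveI := finite_classSet₇
  haveI := subsingleton_classSet
  letI := Fintype.ofFinite (ClassSet (Submodule.span ℤ (Set.range ![(⟨1, 0, 0, 0⟩ : ℍ[ℚ,-1,-7]), ⟨0, 1, 0, 0⟩, ⟨1/2, 0, 1/2, 0⟩, ⟨0, 1/2, 0, 1/2⟩])))
  have h := setup_facts.1 hp (fun h7 => hp7 ((Nat.prime_dvd_prime_iff_eq hp Nat.prime_seven).1 h7)) j
  rwa [Fintype.sum_subsingleton _ i] at h

/-- **`T(7)² = 1`** (the ramified prime: `T(7)` is an involutive permutation matrix). [cite: Eichler1973, Ch. II §6 Thm. 2 (20)] [cite: VignerasLNM800, Ch. III §5 exercice 5.8 (b)] -/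
theorem matrix_seven_mul_self [Fintype (ClassSet (Submodule.span ℤ (Set.range ![(⟨1, 0, 0, 0⟩ : ℍ[ℚ,-1,-7]), ⟨0, 1, 0, 0⟩, ⟨1/2, 0, 1/2, 0⟩, ⟨0, 1/2, 0, 1/2⟩])))] [DecidableEq (ClassSet (Submodule.span ℤ (Set.range ![(⟨1, 0, 0, 0⟩ : ℍ[ℚ,-1,-7]), ⟨0, 1, 0, 0⟩, ⟨1/2, 0, 1/2, 0⟩, ⟨0, 1/2, 0, 1/2⟩])))] : matrix (Submodule.span ℤ (Set.range ![(⟨1, 0, 0, 0⟩ : ℍ[ℚ,-1,-7]), ⟨0, 1, 0, 0⟩, ⟨1/2, 0, 1/2, 0⟩, ⟨0, 1/2, 0, 1/2⟩])) 7 * matrix (Submodule.span ℤ (Set.range ![(⟨1, 0, 0, 0⟩ : ℍ[ℚ,-1,-7]), ⟨0, 1, 0, 0⟩, ⟨1/2, 0, 1/2, 0⟩, ⟨0, 1/2, 0, 1/2⟩])) 7 = 1 :=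
  setup_facts.2.1

/-- `T(1)_ij = 1`. [cite: Voight2021, 41.1.1] -/
theorem matrix_one' (i j : ClassSet (Submodule.span ℤ (Set.range ![(⟨1, 0, 0, 0⟩ : ℍ[ℚ,-1,-7]), ⟨0, 1, 0, 0⟩, ⟨1/2, 0, 1/2, 0⟩, ⟨0, 1/2, 0, 1/2⟩]))) : matrix (Submodule.span ℤ (Set.range ![(⟨1, 0, 0, 0⟩ : ℍ[ℚ,-1,-7]), ⟨0, 1, 0, 0⟩, ⟨1/2, 0, 1/2, 0⟩, ⟨0, 1/2, 0, 1/2⟩])) 1 i j = 1 := by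
  classical
  haveI := subsingleton_classSet
  rw [matrix_one, Subsingleton.elim i j, Matrix.one_apply_eq]

/-- `T(mn) = T(m) T(n)` for coprime `m, n` (at `O₇`). [cite: VignerasLNM800, Ch. III §5 exercice 5.8 (c)] -/
theorem matrix_mul_of_coprime' [Fintype (ClassSet (Submodule.span ℤ (Set.range ![(⟨1, 0, 0, 0⟩ : ℍ[ℚ,-1,-7]), ⟨0, 1, 0, 0⟩, ⟨1/2, 0, 1/2, 0⟩, ⟨0, 1/2, 0, 1/2⟩])))] {m n : ℕ} (hmn : Nat.Coprime m n) :
    matrix (Submodule.span ℤ (Set.range ![(⟨1, 0, 0, 0⟩ : ℍ[ℚ,-1,-7]), ⟨0, 1, 0, 0⟩, ⟨1/2, 0, 1/2, 0⟩, ⟨0, 1/2, 0, 1/2⟩])) (m * n) = matrix (Submodule.span ℤ (Set.range ![(⟨1, 0, 0, 0⟩ : ℍ[ℚ,-1,-7]), ⟨0, 1, 0, 0⟩, ⟨1/2, 0, 1/2, 0⟩, ⟨0, 1/2, 0, 1/2⟩])) m * matrix (Submodule.span ℤ (Set.range ![(⟨1, 0, 0, 0⟩ : ℍ[ℚ,-1,-7]),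 ⟨0, 1, 0, 0⟩, ⟨1/2, 0, 1/2, 0⟩, ⟨0, 1/2, 0, 1/2⟩])) n :=
  setup_facts.2.2.1 hmn

/-- Products of `1 × 1` matrices, entrywise. [folklore] -/
private theorem mul_apply₇ [Fintype (ClassSet (Submodule.span ℤ (Set.range ![(⟨1, 0, 0, 0⟩ : ℍ[ℚ,-1,-7]), ⟨0, 1, 0, 0⟩, ⟨1/2, 0, 1/2, 0⟩, ⟨0, 1/2, 0, 1/2⟩])))] (A C : Matrix (ClassSet (Submodule.span ℤ (Set.range ![(⟨1, 0, 0, 0⟩ : ℍ[ℚ,-1,-7]), ⟨0, 1, 0, 0⟩, ⟨1/2, 0, 1/2, 0⟩, ⟨0, 1/2, 0, 1/2⟩]))) (ClassSet (Submodule.span ℤ (Set.range ![(⟨1, 0, 0, 0⟩ : ℍ[ℚ,-1,-7]), ⟨0, 1, 0, 0⟩, ⟨1/2, 0, 1/2, 0⟩, ⟨0, 1/2, 0, 1/2⟩]))) ℤ) (i j : ClassSet (Submodule.span ℤ (Set.range ![(⟨1, 0, 0, 0⟩ : ℍ[ℚ,-1,-7]), ⟨0, 1, 0, 0⟩, ⟨1/2,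 0, 1/2, 0⟩, ⟨0, 1/2, 0, 1/2⟩]))) :
    (A * C) i j = A i j * C i j := by
  haveI := subsingleton_classSet
  rw [Matrix.mul_apply, Fintype.sum_subsingleton _ i, Subsingleton.elim j i]

/-- `T(mn)_ij = T(m)_ij T(n)_ij` for coprime `m, n` (one class). [cite: VignerasLNM800, Ch. III §5 exercice 5.8 (c)] -/
theorem matrix_apply_mul_of_coprime {m n : ℕ} (hmn : Nat.Coprime m n) (i j : ClassSet (Submodule.span ℤ (Set.range ![(⟨1, 0, 0, 0⟩ : ℍ[ℚ,-1,-7]), ⟨0, 1, 0, 0⟩, ⟨1/2, 0, 1/2, 0⟩, ⟨0, 1/2, 0, 1/2⟩]))) :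
    matrix (Submodule.span ℤ (Set.range ![(⟨1, 0, 0, 0⟩ : ℍ[ℚ,-1,-7]), ⟨0, 1, 0, 0⟩, ⟨1/2, 0, 1/2, 0⟩, ⟨0, 1/2, 0, 1/2⟩])) (m * n) i j = matrix (Submodule.span ℤ (Set.range ![(⟨1, 0, 0, 0⟩ : ℍ[ℚ,-1,-7]), ⟨0, 1, 0, 0⟩, ⟨1/2, 0, 1/2, 0⟩, ⟨0, 1/2, 0, 1/2⟩])) m i j * matrix (Submodule.span ℤ (Set.range ![(⟨1, 0, 0, 0⟩ : ℍ[ℚ,-1,-7]), ⟨0, 1, 0, 0⟩, ⟨1/2, 0, 1/2, 0⟩, ⟨0, 1/2, 0, 1/2⟩])) n i j := by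
  haveI := finite_classSet₇
  letI := Fintype.ofFinite (ClassSet (Submodule.span ℤ (Set.range ![(⟨1, 0, 0, 0⟩ : ℍ[ℚ,-1,-7]), ⟨0, 1, 0, 0⟩, ⟨1/2, 0, 1/2, 0⟩, ⟨0, 1/2, 0, 1/2⟩])))
  rw [matrix_mul_of_coprime' hmn, mul_apply₇]

/-- **`#{x ∈ O₇ : nrd x = n} = 4 · T(n)_ii`** (`2w = #O₇^× = 4`; the numerators are class functions). [cite: Voight2021, Lemma 41.2.7 and Thm. 11.5.14] -/
theorem natCard_reducedNorm_eq_four_mul_matrix {n : ℕ} (hn : n ≠ 0) (i : ClassSet (Submodule.span ℤ (Set.range ![(⟨1, 0, 0, 0⟩ : ℍ[ℚ,-1,-7]), ⟨0, 1, 0, 0⟩, ⟨1/2, 0, 1/2, 0⟩, ⟨0, 1/2, 0, 1/2⟩]))) :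
    (Nat.card {x : ℍ[ℚ,-1,-7] // x ∈ (Submodule.span ℤ (Set.range ![(⟨1, 0, 0, 0⟩ : ℍ[ℚ,-1,-7]), ⟨0, 1, 0, 0⟩, ⟨1/2, 0, 1/2, 0⟩, ⟨0, 1/2, 0, 1/2⟩])) ∧ reducedNorm ℚ ℍ[ℚ,-1,-7] x = n} : ℤ) = 4 * matrix (Submodule.span ℤ (Set.range ![(⟨1, 0, 0, 0⟩ : ℍ[ℚ,-1,-7]), ⟨0, 1, 0, 0⟩, ⟨1/2, 0, 1/2, 0⟩, ⟨0, 1/2, 0, 1/2⟩])) n i i := by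
  have h := setup_facts.2.2.2 hn i
  rw [weight_eq_two, card_normSet_rep] at h
  push_cast at h
  linarith

/-- **`T(7ᵃ)_ij = 1` for every `a`** (`4·T(7ᵃ)_ii = #{x ∈ O₇ : nrd x = 7ᵃ} = 4`: the elements of norm `7ᵃ` are the `4` units
times `jᵃ` — the unique two-sided ideal `𝔓ᵃ` above the ramified prime). [cite: Eichler1973, Ch. II §6 Thm. 2 (20)] [cite: Voight2021, Exercise 17.10] -/
theorem matrix_seven_pow (a : ℕ) (i j : ClassSet (Submodule.span ℤ (Set.range ![(⟨1, 0, 0, 0⟩ : ℍ[ℚ,-1,-7]), ⟨0, 1, 0, 0⟩, ⟨1/2, 0, 1/2, 0⟩, ⟨0, 1/2, 0, 1/2⟩]))) : matrix (Submodule.span ℤ (Set.range ![(⟨1, 0, 0, 0⟩ : ℍ[ℚ,-1,-7]), ⟨0, 1, 0, 0⟩, ⟨1/2, 0, 1/2, 0⟩, ⟨0, 1/2, 0, 1/2⟩])) (7 ^ a) i j = 1 := by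
  haveI := finite_classSet₇
  haveI := subsingleton_classSet
  rw [Subsingleton.elim i j]
  have h := natCard_reducedNorm_eq_four_mul_matrix (pow_ne_zero a (by norm_num : (7 : ℕ) ≠ 0)) j
  rw [natCard_reducedNorm_seven_pow a] at h
  push_cast at h
  linarith

/-- **`T(7)_ij = 1`** (the ramified prime). [cite: Eichler1973, Ch. II §6 Thm. 2 (20)] [cite: VignerasLNM800, Ch. III §5 exercice 5.8 (b)] -/
theorem matrix_seven (i j : ClassSet (Submodule.span ℤ (Set.range ![(⟨1, 0, 0, 0⟩ : ℍ[ℚ,-1,-7]), ⟨0, 1, 0, 0⟩, ⟨1/2, 0, 1/2, 0⟩, ⟨0, 1/2, 0, 1/2⟩]))) : matrix (Submodule.span ℤ (Set.range ![(⟨1, 0, 0, 0⟩ : ℍ[ℚ,-1,-7]), ⟨0, 1, 0, 0⟩, ⟨1/2, 0, 1/2, 0⟩, ⟨0, 1/2, 0, 1/2⟩])) 7 i j = 1 := by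
  have h := matrix_seven_pow 1 i j
  rwa [pow_one] at h

/-- **`#{x ∈ O₇ : nrd x = p} = 4(p + 1)` for every prime `p ≠ 7`.** [cite: Voight2021, Exercise 11.14 (c)–(d) (the analogous count for the Hurwitz order) and Exercise 17.10] [cite: Eichler1973, Ch. II §6 Thm. 2 Cor. 1] -/
theorem natCard_reducedNorm_prime {p : ℕ} (hp : p.Prime) (hp7 : p ≠ 7) :
    Nat.card {x : ℍ[ℚ,-1,-7] // x ∈ (Submodule.span ℤ (Set.range ![(⟨1, 0, 0, 0⟩ : ℍ[ℚ,-1,-7]), ⟨0, 1, 0, 0⟩, ⟨1/2, 0, 1/2, 0⟩, ⟨0, 1/2, 0, 1/2⟩])) ∧ reducedNorm ℚ ℍ[ℚ,-1,-7] x = p} = 4 * (p + 1) := by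
  haveI := finite_classSet₇
  have c₀ : ClassSet (Submodule.span ℤ (Set.range ![(⟨1, 0, 0, 0⟩ : ℍ[ℚ,-1,-7]), ⟨0, 1, 0, 0⟩, ⟨1/2, 0, 1/2, 0⟩, ⟨0, 1/2, 0, 1/2⟩])) := Quotient.mk (rightClassSetoid (Submodule.span ℤ (Set.range ![(⟨1, 0, 0, 0⟩ : ℍ[ℚ,-1,-7]), ⟨0, 1, 0, 0⟩, ⟨1/2, 0, 1/2, 0⟩, ⟨0, 1/2, 0, 1/2⟩]))) ⟨(Submodule.span ℤ (Set.range ![(⟨1, 0, 0, 0⟩ : ℍ[ℚ,-1,-7]), ⟨0, 1, 0, 0⟩, ⟨1/2, 0, 1/2, 0⟩, ⟨0, 1/2, 0, 1/2⟩])), lattice_mem_rightIdeals⟩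
  have h := natCard_reducedNorm_eq_four_mul_matrix hp.ne_zero c₀
  rw [matrix_prime hp hp7] at h
  exact_mod_cast h

/-- The count in the coordinates of `O₇`, for a natural number `n`. [cite: Voight2021, Exercise 17.10 (b)] -/
theorem natCard_form_eq_natCard_reducedNorm (n : ℕ) :
    Nat.card {v : ℤ × ℤ × ℤ × ℤ //
        v.1 ^ 2 + v.1 * v.2.2.1 + 2 * v.2.2.1 ^ 2 + v.2.1 ^ 2 + v.2.1 * v.2.2.2 + 2 * v.2.2.2 ^ 2 = n} =
      Nat.card {x : ℍ[ℚ,-1,-7] // x ∈ (Submodule.span ℤ (Set.range ![(⟨1, 0, 0, 0⟩ : ℍ[ℚ,-1,-7]), ⟨0, 1, 0, 0⟩, ⟨1/2, 0, 1/2, 0⟩, ⟨0, 1/2, 0, 1/2⟩])) ∧ reducedNorm ℚ ℍ[ℚ,-1,-7] x = n} := by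
  rw [← natCard_reducedNorm_eq_natCard_form (n : ℤ)]
  exact Nat.card_congr (Equiv.subtypeEquivRight fun x => by rw [Int.cast_natCast])

/-- **EICHLER'S ROW SUM AT PRIMES: the number of `(a, b, c, d) ∈ ℤ⁴` with `a² + ac + 2c² + b² + bd + 2d² = p` is
`4(p + 1)` for every prime `p ≠ 7`** (by `# Cls O₇ = 1` and Eichler's `p + 1` ideals of norm `p`). [cite: Eichler1973, Ch. II §6 Thm. 2 Cor. 1] [cite: Voight2021, Exercise 17.10 (b) and Exercise 11.14 (c)] -/
theorem natCard_form_prime {p : ℕ} (hp : p.Prime) (hp7 : p ≠ 7) :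
    Nat.card {v : ℤ × ℤ × ℤ × ℤ //
        v.1 ^ 2 + v.1 * v.2.2.1 + 2 * v.2.2.1 ^ 2 + v.2.1 ^ 2 + v.2.1 * v.2.2.2 + 2 * v.2.2.2 ^ 2 = p} = 4 * (p + 1) := by
  rw [natCard_form_eq_natCard_reducedNorm, natCard_reducedNorm_prime hp hp7]

/-- `σ(p) = p + 1`. [folklore] -/
private theorem sigma_one_prime {p : ℕ} (hp : p.Prime) : ArithmeticFunction.sigma 1 p = p + 1 := by
  have h := ArithmeticFunction.sigma_one_apply_prime_pow hp (i := 1)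
  rw [pow_one] at h
  rw [h, Finset.sum_range_succ, Finset.sum_range_succ, Finset.sum_range_zero, pow_zero, pow_one, zero_add, add_comm]

/-- **`T(n)_ij = σ(n)` for squarefree `n` prime to `7`** (multiplicativity over the primes `p ∣ n`, `T(p) = p + 1 = σ(p)`).
[cite: Eichler1973, Ch. II §6 (16), Thm. 2 (18) and Cor. 1] [cite: VignerasLNM800, Ch. III §5 exercice 5.8 (c)] -/
theorem matrix_apply_of_squarefree {n : ℕ} (hn : Squarefree n) (h7 : ¬ 7 ∣ n) (i j : ClassSet (Submodule.span ℤ (Set.range ![(⟨1, 0, 0, 0⟩ : ℍ[ℚ,-1,-7]), ⟨0, 1, 0, 0⟩, ⟨1/2, 0, 1/2, 0⟩, ⟨0, 1/2, 0, 1/2⟩]))) :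
    matrix (Submodule.span ℤ (Set.range ![(⟨1, 0, 0, 0⟩ : ℍ[ℚ,-1,-7]), ⟨0, 1, 0, 0⟩, ⟨1/2, 0, 1/2, 0⟩, ⟨0, 1/2, 0, 1/2⟩])) n i j = ArithmeticFunction.sigma 1 n := by
  induction n using Nat.recOnPrimeCoprime generalizing i j with
  | zero => exact absurd hn not_squarefree_zero
  | prime_pow p a hp =>
    rcases Nat.eq_zero_or_pos a with rfl | ha
    · rw [pow_zero, matrix_one', ArithmeticFunction.sigma_one_apply, Nat.divisors_one, sum_singleton, Nat.cast_one]
    · have ha1 : a = 1 := ((Nat.squarefree_pow_iff hp.ne_one ha.ne').1 hn).2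
      subst ha1
      rw [pow_one] at h7 ⊢
      have hp7 : p ≠ 7 := fun h => h7 (h ▸ dvd_refl p)
      rw [matrix_prime hp hp7, sigma_one_prime hp, Nat.cast_add, Nat.cast_one]
  | coprime a b ha hb hab iha ihb =>
    rw [matrix_apply_mul_of_coprime hab, iha (Squarefree.of_mul_left hn) (fun h => h7 (dvd_mul_of_dvd_left h b)),
      ihb (Squarefree.of_mul_right hn) (fun h => h7 (dvd_mul_of_dvd_right h a)),
      ArithmeticFunction.isMultiplicative_sigma.map_mul_of_coprime hab, Nat.cast_mul]

/-- **`T(7ᵃm)_ij = T(m)_ij` for `m` prime to `7`** (`T(7ᵃ) = 1`). [cite: Eichler1973, Ch. II §6 Thm. 2 (18), (20)] -/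
theorem matrix_apply_seven_pow_mul (a : ℕ) {m : ℕ} (h7 : ¬ 7 ∣ m) (i j : ClassSet (Submodule.span ℤ (Set.range ![(⟨1, 0, 0, 0⟩ : ℍ[ℚ,-1,-7]), ⟨0, 1, 0, 0⟩, ⟨1/2, 0, 1/2, 0⟩, ⟨0, 1/2, 0, 1/2⟩]))) :
    matrix (Submodule.span ℤ (Set.range ![(⟨1, 0, 0, 0⟩ : ℍ[ℚ,-1,-7]), ⟨0, 1, 0, 0⟩, ⟨1/2, 0, 1/2, 0⟩, ⟨0, 1/2, 0, 1/2⟩])) (7 ^ a * m) i j = matrix (Submodule.span ℤ (Set.range ![(⟨1, 0, 0, 0⟩ : ℍ[ℚ,-1,-7]), ⟨0, 1, 0, 0⟩, ⟨1/2, 0, 1/2, 0⟩, ⟨0, 1/2, 0, 1/2⟩])) m i j := by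
  rw [matrix_apply_mul_of_coprime (Nat.Coprime.pow_left a ((Nat.Prime.coprime_iff_not_dvd Nat.prime_seven).2 h7)),
    matrix_seven_pow, one_mul]

/-- **`T(7ᵃm)_ij = σ(m)` for squarefree `m` prime to `7`.** [cite: Eichler1973, Ch. II §6 Thm. 2 (18), (20) and Cor. 1] -/
theorem matrix_apply_seven_pow_mul_of_squarefree (a : ℕ) {m : ℕ} (hm : Squarefree m) (h7 : ¬ 7 ∣ m) (i j : ClassSet (Submodule.span ℤ (Set.range ![(⟨1, 0, 0, 0⟩ : ℍ[ℚ,-1,-7]), ⟨0, 1, 0, 0⟩, ⟨1/2, 0, 1/2, 0⟩, ⟨0, 1/2, 0, 1/2⟩]))) :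
    matrix (Submodule.span ℤ (Set.range ![(⟨1, 0, 0, 0⟩ : ℍ[ℚ,-1,-7]), ⟨0, 1, 0, 0⟩, ⟨1/2, 0, 1/2, 0⟩, ⟨0, 1/2, 0, 1/2⟩])) (7 ^ a * m) i j = ArithmeticFunction.sigma 1 m := by
  rw [matrix_apply_seven_pow_mul a h7, matrix_apply_of_squarefree hm h7]

/-- **EICHLER'S ROW SUM FOR SQUAREFREE `n` PRIME TO `7`: `r₇(n) = #{a² + ac + 2c² + b² + bd + 2d² = n} = 4σ(n)`.**
[cite: Eichler1973, Ch. II §6 Thm. 2 Cor. 1] [cite: Voight2021, Exercise 17.10 (b)] -/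
theorem natCard_form_of_squarefree {n : ℕ} (hn : Squarefree n) (h7 : ¬ 7 ∣ n) :
    Nat.card {v : ℤ × ℤ × ℤ × ℤ //
        v.1 ^ 2 + v.1 * v.2.2.1 + 2 * v.2.2.1 ^ 2 + v.2.1 ^ 2 + v.2.1 * v.2.2.2 + 2 * v.2.2.2 ^ 2 = n} =
      4 * ArithmeticFunction.sigma 1 n := by
  haveI := finite_classSet₇
  have c₀ : ClassSet (Submodule.span ℤ (Set.range ![(⟨1, 0, 0, 0⟩ : ℍ[ℚ,-1,-7]), ⟨0, 1, 0, 0⟩, ⟨1/2, 0, 1/2, 0⟩, ⟨0, 1/2, 0, 1/2⟩])) := Quotient.mk (rightClassSetoid (Submodule.span ℤ (Set.range ![(⟨1, 0, 0, 0⟩ : ℍ[ℚ,-1,-7]), ⟨0, 1, 0, 0⟩, ⟨1/2, 0, 1/2, 0⟩, ⟨0, 1/2, 0, 1/2⟩]))) ⟨(Submodule.span ℤ (Set.range ![(⟨1, 0, 0, 0⟩ : ℍ[ℚ,-1,-7]), ⟨0, 1, 0, 0⟩, ⟨1/2, 0, 1/2, 0⟩, ⟨0, 1/2, 0, 1/2⟩])),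 lattice_mem_rightIdeals⟩
  have h := natCard_reducedNorm_eq_four_mul_matrix hn.ne_zero c₀
  rw [matrix_apply_of_squarefree hn h7, ← natCard_form_eq_natCard_reducedNorm] at h
  exact_mod_cast h

/-- **`r₇(7ᵃm) = 4σ(m)` for squarefree `m` prime to `7`** (`= 4·Σ_{d ∣ 7ᵃm, 7 ∤ d} d`). [cite: Eichler1973, Ch. II §6 Thm. 2 (20) and Cor. 1] [cite: Voight2021, Exercise 17.10 (b)] -/
theorem natCard_form_seven_pow_mul_of_squarefree (a : ℕ) {m : ℕ} (hm : Squarefree m) (h7 : ¬ 7 ∣ m) :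
    Nat.card {v : ℤ × ℤ × ℤ × ℤ //
        v.1 ^ 2 + v.1 * v.2.2.1 + 2 * v.2.2.1 ^ 2 + v.2.1 ^ 2 + v.2.1 * v.2.2.2 + 2 * v.2.2.2 ^ 2 = (7 ^ a * m : ℕ)} =
      4 * ArithmeticFunction.sigma 1 m := by
  haveI := finite_classSet₇
  have c₀ : ClassSet (Submodule.span ℤ (Set.range ![(⟨1, 0, 0, 0⟩ : ℍ[ℚ,-1,-7]), ⟨0, 1, 0, 0⟩, ⟨1/2, 0, 1/2, 0⟩, ⟨0, 1/2, 0, 1/2⟩])) := Quotient.mk (rightClassSetoid (Submodule.span ℤ (Set.range ![(⟨1, 0, 0, 0⟩ : ℍ[ℚ,-1,-7]), ⟨0, 1, 0, 0⟩, ⟨1/2, 0, 1/2, 0⟩, ⟨0, 1/2, 0, 1/2⟩]))) ⟨(Submodule.span ℤ (Set.range ![(⟨1, 0, 0, 0⟩ : ℍ[ℚ,-1,-7]), ⟨0, 1, 0, 0⟩, ⟨1/2, 0, 1/2, 0⟩, ⟨0, 1/2, 0, 1/2⟩])), lattice_mem_rightIdeals⟩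
  have h := natCard_reducedNorm_eq_four_mul_matrix (mul_ne_zero (pow_ne_zero a (by norm_num : (7 : ℕ) ≠ 0)) hm.ne_zero) c₀
  rw [matrix_apply_seven_pow_mul_of_squarefree a hm h7, ← natCard_form_eq_natCard_reducedNorm] at h
  exact_mod_cast h

/-- **`#{x ∈ O₇ : nrd x = 7ᵃm} = 4σ(m)` for squarefree `m` prime to `7`.** [cite: Eichler1973, Ch. II §6 Thm. 2 (20) and Cor. 1] -/
theorem natCard_reducedNorm_seven_pow_mul_of_squarefree (a : ℕ) {m : ℕ} (hm : Squarefree m) (h7 : ¬ 7 ∣ m) :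
    Nat.card {x : ℍ[ℚ,-1,-7] // x ∈ (Submodule.span ℤ (Set.range ![(⟨1, 0, 0, 0⟩ : ℍ[ℚ,-1,-7]), ⟨0, 1, 0, 0⟩, ⟨1/2, 0, 1/2, 0⟩, ⟨0, 1/2, 0, 1/2⟩])) ∧ reducedNorm ℚ ℍ[ℚ,-1,-7] x = (7 ^ a * m : ℕ)} = 4 * ArithmeticFunction.sigma 1 m := by
  rw [← natCard_form_eq_natCard_reducedNorm, natCard_form_seven_pow_mul_of_squarefree a hm h7]

end AtO

/-! ## §2 Every Brandt setup of type `(1, 7)` -/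

section Setup

/-- **The definite quaternion algebra over `ℚ` of discriminant `7` is `(−1,−7 ∣ ℚ)`**: the algebra of every Brandt setup of
type `(1, 7)` is isomorphic to `ℍ[ℚ,−1,−7]` (same finite ramification `{v ∣ 7}`, both ramified at `∞`).
[cite: VignerasLNM800, Ch. III §3 Thm. 3.1] [cite: Voight2021, Thm. 25.4.1 (D = 7)] -/
theorem xiSetup_nonempty_algEquiv (S : XiSetup 1 7) : Nonempty (S.D ≃ₐ[ℚ] ℍ[ℚ,-1,-7]) := by
  haveI := isQuaternionAlgebra
  have hf : ramifiedPlaces ℚ S.D = ramifiedPlaces ℚ ℍ[ℚ,-1,-7] := by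
    rw [ramifiedPlaces_eq, S.ramifiedPlaces_eq]
  have hi : ramifiedInfinitePlaces ℚ S.D = ramifiedInfinitePlaces ℚ ℍ[ℚ,-1,-7] := by
    ext w
    simp only [mem_ramifiedInfinitePlaces_iff]
    exact ⟨fun _ => isTotallyDefinite w, fun _ => S.isTotallyDefinite w⟩
  exact nonempty_algEquiv_of_ramifiedPlaces_eq_holds ℚ S.D ℍ[ℚ,-1,-7] hf hi

/-- The transport: class set, weights and Brandt matrices of `S.O` correspond to those of `O₇` (the type-`(1, 7)` instance of
`Brandt.XiSetup.exists_classSetEquiv`: along `ℍ[ℚ,−1,−7] ≃ S.D` and a connecting ideal between the two Eichler orders of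
level `1`). [cite: VignerasLNM800, Ch. III §5 Cor. 5.5 and §5 B] -/
private theorem exists_classSetEquiv_xiSetup (S : XiSetup 1 7) :
    ∃ ε : ClassSet (Submodule.span ℤ (Set.range ![(⟨1, 0, 0, 0⟩ : ℍ[ℚ,-1,-7]), ⟨0, 1, 0, 0⟩, ⟨1/2, 0, 1/2, 0⟩, ⟨0, 1/2, 0, 1/2⟩])) ≃ ClassSet S.O, (∀ c, weight S.O (ε c) = weight (Submodule.span ℤ (Set.range ![(⟨1, 0, 0, 0⟩ : ℍ[ℚ,-1,-7]), ⟨0, 1, 0, 0⟩, ⟨1/2, 0, 1/2, 0⟩, ⟨0, 1/2, 0, 1/2⟩])) c) ∧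
      ∀ n c d, Brandt.matrix S.O n (ε c) (ε d) = Brandt.matrix (Submodule.span ℤ (Set.range ![(⟨1, 0, 0, 0⟩ : ℍ[ℚ,-1,-7]), ⟨0, 1, 0, 0⟩, ⟨1/2, 0, 1/2, 0⟩, ⟨0, 1/2, 0, 1/2⟩])) n c d := by
  haveI := isQuaternionAlgebra
  obtain ⟨e'⟩ := xiSetup_nonempty_algEquiv S
  have e : ℍ[ℚ,-1,-7] ≃+* S.D := e'.symm.toRingEquiv
  obtain ⟨ε₁, -, hw₁, hT₁⟩ := exists_classSetEquiv_map_ringEquiv e (Submodule.span ℤ (Set.range ![(⟨1, 0, 0, 0⟩ : ℍ[ℚ,-1,-7]), ⟨0, 1, 0, 0⟩, ⟨1/2, 0, 1/2, 0⟩, ⟨0, 1/2, 0, 1/2⟩]))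
  have hdiv : ∀ y : S.D, y ≠ 0 → IsUnit y := fun y hy =>
    isUnit_of_isTotallyDefinite S.D S.isTotallyDefinite hy
  have hO₁ : Brandt.IsEichlerOrder S.D (((Submodule.span ℤ (Set.range ![(⟨1, 0, 0, 0⟩ : ℍ[ℚ,-1,-7]), ⟨0, 1, 0, 0⟩, ⟨1/2, 0, 1/2, 0⟩, ⟨0, 1/2, 0, 1/2⟩]))).map (e.toAddEquiv.toIntLinearEquiv : ℍ[ℚ,-1,-7] →ₗ[ℤ] S.D)) 1 :=
    brandt_isEichlerOrder_one_lattice.map_ringEquiv e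
  obtain ⟨I, hI, hIO⟩ := (isEichlerOrder_iff_brandt.mpr hO₁).exists_isInvertibleRightIdeal_leftOrderOf_eq
    hdiv (isEichlerOrder_iff_brandt.mpr S.isEichlerOrder) one_ne_zero
  have hImem : I ∈ Brandt.rightIdeals (((Submodule.span ℤ (Set.range ![(⟨1, 0, 0, 0⟩ : ℍ[ℚ,-1,-7]), ⟨0, 1, 0, 0⟩, ⟨1/2, 0, 1/2, 0⟩, ⟨0, 1/2, 0, 1/2⟩]))).map (e.toAddEquiv.toIntLinearEquiv : ℍ[ℚ,-1,-7] →ₗ[ℤ] S.D)) := by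
    rw [rightIdeals_eq_invertibleRightIdeals_of_isTotallyDefinite S.isTotallyDefinite
      (isZOrder_iff_isOrder.mpr hO₁.isOrder)]
    exact hI
  have hIO' : Brandt.leftOrder I = S.O := hIO
  obtain ⟨ε₂, hw₂, hT₂⟩ :
      ∃ ε₂ : ClassSet (((Submodule.span ℤ (Set.range ![(⟨1, 0, 0, 0⟩ : ℍ[ℚ,-1,-7]), ⟨0, 1, 0, 0⟩, ⟨1/2, 0, 1/2, 0⟩, ⟨0, 1/2, 0, 1/2⟩]))).map (e.toAddEquiv.toIntLinearEquiv : ℍ[ℚ,-1,-7] →ₗ[ℤ] S.D)) ≃ ClassSet S.O,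
        (∀ c, weight S.O (ε₂ c) = weight (((Submodule.span ℤ (Set.range ![(⟨1, 0, 0, 0⟩ : ℍ[ℚ,-1,-7]), ⟨0, 1, 0, 0⟩, ⟨1/2, 0, 1/2, 0⟩, ⟨0, 1/2, 0, 1/2⟩]))).map (e.toAddEquiv.toIntLinearEquiv : ℍ[ℚ,-1,-7] →ₗ[ℤ] S.D)) c) ∧
        ∀ n c d, Brandt.matrix S.O n (ε₂ c) (ε₂ d) =
          Brandt.matrix (((Submodule.span ℤ (Set.range ![(⟨1, 0, 0, 0⟩ : ℍ[ℚ,-1,-7]), ⟨0, 1, 0, 0⟩, ⟨1/2, 0, 1/2, 0⟩, ⟨0, 1/2, 0, 1/2⟩]))).map (e.toAddEquiv.toIntLinearEquiv : ℍ[ℚ,-1,-7] →ₗ[ℤ] S.D)) n c d := by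
    rw [← hIO']
    exact exists_classSetEquiv_leftOrder S.isTotallyDefinite hO₁.isOrder hImem
  exact ⟨ε₁.trans ε₂, fun c => by rw [Equiv.trans_apply, hw₂, hw₁],
    fun n c d => by rw [Equiv.trans_apply, Equiv.trans_apply, hT₂, hT₁]⟩

/-- **`h(7, 1) = 1`: the class set of every maximal order of the definite quaternion algebra of discriminant `7` is a point**
(Voight Thm. 25.4.1 at `D = 7`). [cite: Voight2021, Thm. 25.4.1 (D = 7) and Exercise 17.10 (a)] -/
theorem xiSetup_natCard_classSet (S : XiSetup 1 7) : Nat.card (ClassSet S.O) = 1 := by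
  obtain ⟨ε, -, -⟩ := exists_classSetEquiv_xiSetup S
  rw [← Nat.card_congr ε]
  exact card_classSet

/-- `Cls S.O` has at most one element. [cite: Voight2021, Thm. 25.4.1 (D = 7)] -/
theorem xiSetup_subsingleton_classSet (S : XiSetup 1 7) : Subsingleton (ClassSet S.O) :=
  (Nat.card_eq_one_iff_unique.mp (xiSetup_natCard_classSet S)).1

/-- `Cls S.O` is nonempty. [cite: Voight2021, Thm. 25.4.1 (D = 7)] -/
theorem xiSetup_nonempty_classSet (S : XiSetup 1 7) : Nonempty (ClassSet S.O) :=
  (Nat.card_eq_one_iff_unique.mp (xiSetup_natCard_classSet S)).2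

/-- `# Cls S.O = 1` for any `Fintype` structure on the class set. [cite: Voight2021, Thm. 25.4.1 (D = 7)] -/
theorem xiSetup_card_classSet (S : XiSetup 1 7) [Fintype (ClassSet S.O)] : Fintype.card (ClassSet S.O) = 1 := by
  rw [← Nat.card_eq_fintype_card]
  exact xiSetup_natCard_classSet S

/-- **Every Brandt weight of a setup of type `(1, 7)` is `w = [O_L(I)^× : ℤ^×] = 2`.** [cite: Voight2021, Thm. 25.1.1 and Thm. 11.5.14] -/
theorem xiSetup_weight (S : XiSetup 1 7) (c : ClassSet S.O) : weight S.O c = 2 := by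
  obtain ⟨ε, hw, -⟩ := exists_classSetEquiv_xiSetup S
  rw [← ε.apply_symm_apply c, hw, weight_eq_two]

/-- **EICHLER'S MASS FORMULA AT `(D, N) = (7, 1)`: `Σ_{[J] ∈ Cls O} 1/w_J = φ(7)/12 = 1/2`** for every maximal order of the
definite quaternion algebra of discriminant `7`. [cite: Voight2021, Thm. 25.1.1] [cite: VignerasLNM800, Ch. V §2 Cor. 2.3] -/
theorem xiSetup_sum_inv_weight (S : XiSetup 1 7) [Fintype (ClassSet S.O)] :
    ∑ c, (1 : ℚ) / weight S.O c = 1 / 2 := by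
  haveI := xiSetup_subsingleton_classSet S
  obtain ⟨c₀⟩ := xiSetup_nonempty_classSet S
  rw [Fintype.sum_subsingleton _ c₀, xiSetup_weight]
  norm_num

/-- **`T(p)_ij = p + 1` for every prime `p ≠ 7`, for every setup of type `(1, 7)`.** [cite: Eichler1973, Ch. II §6 (16)] [cite: Voight2021, Exercise 11.14 (c)] -/
theorem xiSetup_matrix_prime (S : XiSetup 1 7) {p : ℕ} (hp : p.Prime) (hp7 : p ≠ 7) (i j : ClassSet S.O) :
    Brandt.matrix S.O p i j = p + 1 := by
  obtain ⟨ε, -, hT⟩ := exists_classSetEquiv_xiSetup S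
  rw [← ε.apply_symm_apply i, ← ε.apply_symm_apply j, hT, matrix_prime hp hp7]

/-- **`T(7ᵃ)_ij = 1` for every setup of type `(1, 7)`** (the ramified prime). [cite: Eichler1973, Ch. II §6 Thm. 2 (20)] [cite: VignerasLNM800, Ch. III §5 exercice 5.8 (b)] -/
theorem xiSetup_matrix_seven_pow (S : XiSetup 1 7) (a : ℕ) (i j : ClassSet S.O) : Brandt.matrix S.O (7 ^ a) i j = 1 := by
  obtain ⟨ε, -, hT⟩ := exists_classSetEquiv_xiSetup S
  rw [← ε.apply_symm_apply i, ← ε.apply_symm_apply j, hT, matrix_seven_pow]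

/-- `T(7)_ij = 1` for every setup of type `(1, 7)`. [cite: Eichler1973, Ch. II §6 Thm. 2 (20)] -/
theorem xiSetup_matrix_seven (S : XiSetup 1 7) (i j : ClassSet S.O) : Brandt.matrix S.O 7 i j = 1 := by
  obtain ⟨ε, -, hT⟩ := exists_classSetEquiv_xiSetup S
  rw [← ε.apply_symm_apply i, ← ε.apply_symm_apply j, hT, matrix_seven]

/-- `T(1)_ij = 1` for every setup of type `(1, 7)`. [cite: Voight2021, 41.1.1] -/
theorem xiSetup_matrix_one (S : XiSetup 1 7) (i j : ClassSet S.O) : Brandt.matrix S.O 1 i j = 1 := by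
  obtain ⟨ε, -, hT⟩ := exists_classSetEquiv_xiSetup S
  rw [← ε.apply_symm_apply i, ← ε.apply_symm_apply j, hT, matrix_one']

/-- **`T(7ᵃm)_ij = σ(m)` for squarefree `m` prime to `7`, for every setup of type `(1, 7)`** (Eichler's Cor. 1: row sums).
[cite: Eichler1973, Ch. II §6 Thm. 2 (18), (20) and Cor. 1] -/
theorem xiSetup_matrix_apply_of_squarefree (S : XiSetup 1 7) (a : ℕ) {m : ℕ} (hm : Squarefree m) (h7 : ¬ 7 ∣ m)
    (i j : ClassSet S.O) : Brandt.matrix S.O (7 ^ a * m) i j = ArithmeticFunction.sigma 1 m := by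
  obtain ⟨ε, -, hT⟩ := exists_classSetEquiv_xiSetup S
  rw [← ε.apply_symm_apply i, ← ε.apply_symm_apply j, hT, matrix_apply_seven_pow_mul_of_squarefree a hm h7]

end Setup

/-! ## §3 Every Eichler package of level `(1, 7)` -/

section Package

/-- **`h = 1` for every Eichler package of level `(1, 7)`** (`Nat.card` of the index type of its Brandt data). [cite: Voight2021, Thm. 25.4.1 (D = 7)] [cite: Pizer1980, §2] -/
theorem eichlerPackage_natCard_ι (P : EichlerPackage 1 7) : Nat.card P.brandtData.ι = 1 := by
  have hO : IsZOrder P.O := P.isEichlerOrder.isZOrder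
  have h := rightIdeals_eq_invertibleRightIdeals_of_isTotallyDefinite P.isTotallyDefinite hO
  rw [EichlerPackage.brandtData_ι, ← Nat.card_congr (ClassSet.equivRightIdealClass h)]
  exact xiSetup_natCard_classSet (P.toXiSetup Nat.prime_seven.prime.squarefree)

/-- **The class number of every Eichler package of level `(1, 7)` is `1`.** [cite: Voight2021, Thm. 25.4.1 (D = 7)] [cite: Pizer1980, §2] -/
theorem eichlerPackage_classNumber (P : EichlerPackage 1 7) : P.brandtData.classNumber = 1 := by
  rw [BrandtData.classNumber, ← Nat.card_eq_fintype_card]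
  exact eichlerPackage_natCard_ι P

/-- The index type of the Brandt data of a package of level `(1, 7)` has at most one element. [cite: Voight2021, Thm. 25.4.1 (D = 7)] -/
theorem eichlerPackage_subsingleton_ι (P : EichlerPackage 1 7) : Subsingleton P.brandtData.ι :=
  (Nat.card_eq_one_iff_unique.mp (eichlerPackage_natCard_ι P)).1

/-- The index type of the Brandt data of a package of level `(1, 7)` is nonempty. [cite: Voight2021, Thm. 25.4.1 (D = 7)] -/
theorem eichlerPackage_nonempty_ι (P : EichlerPackage 1 7) : Nonempty P.brandtData.ι :=
  (Nat.card_eq_one_iff_unique.mp (eichlerPackage_natCard_ι P)).2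

/-- **`w_i = |O_L(I_i)^×|/2 = 2` for every Eichler package of level `(1, 7)`.** [cite: Voight2021, Thm. 25.1.1 and Thm. 11.5.14] -/
theorem eichlerPackage_w (P : EichlerPackage 1 7) (i : P.brandtData.ι) : P.brandtData.w i = 2 := by
  have hO : IsZOrder P.O := P.isEichlerOrder.isZOrder
  have h := rightIdeals_eq_invertibleRightIdeals_of_isTotallyDefinite P.isTotallyDefinite hO
  have key := BrandtData.ofOrder_w_equivRightIdealClass hO h ((ClassSet.equivRightIdealClass h).symm i)
  rw [Equiv.apply_symm_apply] at key
  exact key.trans (xiSetup_weight (P.toXiSetup Nat.prime_seven.prime.squarefree) _)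

/-- `Σ_i 1/w_i = 1/2` for every Eichler package of level `(1, 7)`. [cite: Voight2021, Thm. 25.1.1] [cite: VignerasLNM800, Ch. V §2 Cor. 2.3] -/
theorem eichlerPackage_sum_inv_w (P : EichlerPackage 1 7) : ∑ i, (1 : ℚ) / P.brandtData.w i = 1 / 2 := by
  haveI := eichlerPackage_subsingleton_ι P
  obtain ⟨i₀⟩ := eichlerPackage_nonempty_ι P
  rw [Fintype.sum_subsingleton _ i₀, eichlerPackage_w]
  norm_num

/-- **EICHLER'S MASS FORMULA AT LEVEL `(N⁺, N⁻) = (1, 7)` — the clause `N⁺ = 1`, `N⁻ = 7` of the tree's named fact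
`brandtModule_massFormula`, unconditionally**: for every Eichler package `P` of level `(1, 7)`,
`Σ_i 1/w_i = (1/12) · ∏_{q ∣ 7}(q − 1) · ∏_{p^k ∥ 1} p^{k−1}(p + 1)` (`= 6/12 = 1/2`). [cite: VignerasLNM800, Ch. V §2 Cor. 2.3 (formule de masse d'Eichler)] [cite: Voight2021, Thm. 25.1.1] -/
theorem eichlerPackage_massFormula (P : EichlerPackage 1 7) :
    ∑ i : P.brandtData.ι, (1 : ℚ) / P.brandtData.w i =
      (1 / 12 : ℚ) * (∏ q ∈ (7 : ℕ).primeFactors, ((q : ℚ) - 1)) *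
        ∏ p ∈ (1 : ℕ).primeFactors, (p : ℚ) ^ ((1 : ℕ).factorization p - 1) * ((p : ℚ) + 1) := by
  rw [eichlerPackage_sum_inv_w, Nat.primeFactors_one, Nat.Prime.primeFactors Nat.prime_seven, prod_empty,
    prod_singleton]
  norm_num

/-- **`B(p)_ij = p + 1` for primes `p ≠ 7`, for every Eichler package of level `(1, 7)`.** [cite: Eichler1973, Ch. II §6 (16)] [cite: Pizer1980, §2] -/
theorem eichlerPackage_T_prime (P : EichlerPackage 1 7) {p : ℕ} (hp : p.Prime) (hp7 : p ≠ 7) (i j : P.brandtData.ι) :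
    P.brandtData.T p i j = p + 1 := by
  have hO : IsZOrder P.O := P.isEichlerOrder.isZOrder
  have h := rightIdeals_eq_invertibleRightIdeals_of_isTotallyDefinite P.isTotallyDefinite hO
  have key := BrandtData.ofOrder_T_equivRightIdealClass hO h p ((ClassSet.equivRightIdealClass h).symm i)
    ((ClassSet.equivRightIdealClass h).symm j)
  rw [Equiv.apply_symm_apply, Equiv.apply_symm_apply] at key
  exact key.trans (xiSetup_matrix_prime (P.toXiSetup Nat.prime_seven.prime.squarefree) hp hp7 _ _)

/-- **`B(7ᵃ)_ij = 1` for every Eichler package of level `(1, 7)`.** [cite: Eichler1973, Ch. II §6 Thm. 2 (20)] [cite: Pizer1980, §2] -/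
theorem eichlerPackage_T_seven_pow (P : EichlerPackage 1 7) (a : ℕ) (i j : P.brandtData.ι) : P.brandtData.T (7 ^ a) i j = 1 := by
  have hO : IsZOrder P.O := P.isEichlerOrder.isZOrder
  have h := rightIdeals_eq_invertibleRightIdeals_of_isTotallyDefinite P.isTotallyDefinite hO
  have key := BrandtData.ofOrder_T_equivRightIdealClass hO h (7 ^ a) ((ClassSet.equivRightIdealClass h).symm i)
    ((ClassSet.equivRightIdealClass h).symm j)
  rw [Equiv.apply_symm_apply, Equiv.apply_symm_apply] at key
  exact key.trans (xiSetup_matrix_seven_pow (P.toXiSetup Nat.prime_seven.prime.squarefree) a _ _)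

/-- `B(7)_ij = 1` for every Eichler package of level `(1, 7)`. [cite: Eichler1973, Ch. II §6 Thm. 2 (20)] -/
theorem eichlerPackage_T_seven (P : EichlerPackage 1 7) (i j : P.brandtData.ι) : P.brandtData.T 7 i j = 1 := by
  have h := eichlerPackage_T_seven_pow P 1 i j
  rwa [pow_one] at h

end Package

/-! ## §4 The chosen Brandt data `brandtModule 1 7` -/

section Module

/-- **An explicit Eichler package of level `(1, 7)`: `(ℍ[ℚ,−1,−7], O₇)`** (so `brandtModule 1 7` is not the junk value).
[cite: Voight2021, Exercise 17.10 and Thm. 25.4.1 (D = 7)] -/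
theorem nonempty_eichlerPackage_one_seven : Nonempty (EichlerPackage 1 7) :=
  haveI := isQuaternionAlgebra
  ⟨{ B := ℍ[ℚ,-1,-7]
     instIsQuaternionAlgebra := isQuaternionAlgebra
     isTotallyDefinite := isTotallyDefinite
     mem_ramifiedPlaces_iff := mem_ramifiedPlaces_iff_seven_mem
     O := (Submodule.span ℤ (Set.range ![(⟨1, 0, 0, 0⟩ : ℍ[ℚ,-1,-7]), ⟨0, 1, 0, 0⟩, ⟨1/2, 0, 1/2, 0⟩, ⟨0, 1/2, 0, 1/2⟩]))
     isEichlerOrder := isEichlerOrder_one_lattice }⟩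

/-- **The class number of `brandtModule 1 7` is `1`.** [cite: Voight2021, Thm. 25.4.1 (D = 7)] [cite: Pizer1980, §2] -/
theorem brandtModule_one_seven_classNumber : (brandtModule 1 7).classNumber = 1 := by
  rw [brandtModule_eq nonempty_eichlerPackage_one_seven]
  exact eichlerPackage_classNumber _

/-- **The weights of `brandtModule 1 7` are `3`.** [cite: Voight2021, Thm. 25.1.1 and Thm. 11.5.14] -/
theorem brandtModule_one_seven_w (i : (brandtModule 1 7).ι) : (brandtModule 1 7).w i = 2 := by
  have key : ∀ M : BrandtData.{0}, M = (brandtPackage 1 7 nonempty_eichlerPackage_one_seven).brandtData →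
      ∀ i : M.ι, M.w i = 2 := by
    rintro M rfl i
    exact eichlerPackage_w _ i
  exact key _ (brandtModule_eq _) i

/-- `Σ_i 1/w_i = 1/2` for `brandtModule 1 7` (Eichler's mass formula at `(1, 7)`). [cite: Voight2021, Thm. 25.1.1] [cite: VignerasLNM800, Ch. V §2 Cor. 2.3] -/
theorem brandtModule_one_seven_sum_inv_w : ∑ i, (1 : ℚ) / (brandtModule 1 7).w i = 1 / 2 := by
  have key : ∀ M : BrandtData.{0}, M = (brandtPackage 1 7 nonempty_eichlerPackage_one_seven).brandtData →
      ∑ i, (1 : ℚ) / M.w i = 1 / 2 := by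
    rintro M rfl
    exact eichlerPackage_sum_inv_w _
  exact key _ (brandtModule_eq _)

/-- **`B(p)_ij = p + 1` (`p ≠ 7` prime) for `brandtModule 1 7`.** [cite: Eichler1973, Ch. II §6 (16)] [cite: Pizer1980, §2] -/
theorem brandtModule_one_seven_T_prime {p : ℕ} (hp : p.Prime) (hp7 : p ≠ 7) (i j : (brandtModule 1 7).ι) :
    (brandtModule 1 7).T p i j = p + 1 := by
  have key : ∀ M : BrandtData.{0}, M = (brandtPackage 1 7 nonempty_eichlerPackage_one_seven).brandtData →
      ∀ i j : M.ι, M.T p i j = p + 1 := by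
    rintro M rfl i j
    exact eichlerPackage_T_prime _ hp hp7 i j
  exact key _ (brandtModule_eq _) i j

/-- **`B(7ᵃ)_ij = 1` for `brandtModule 1 7`.** [cite: Eichler1973, Ch. II §6 Thm. 2 (20)] [cite: Pizer1980, §2] -/
theorem brandtModule_one_seven_T_seven_pow (a : ℕ) (i j : (brandtModule 1 7).ι) : (brandtModule 1 7).T (7 ^ a) i j = 1 := by
  have key : ∀ M : BrandtData.{0}, M = (brandtPackage 1 7 nonempty_eichlerPackage_one_seven).brandtData →
      ∀ i j : M.ι, M.T (7 ^ a) i j = 1 := by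
    rintro M rfl i j
    exact eichlerPackage_T_seven_pow _ a i j
  exact key _ (brandtModule_eq _) i j

end Module

end Literature.NumberTheory.Automorphic.MaxOrderDiscSeven
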